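import Mathlib
import HarnessLib
import Summits.NavierStokesRegularity.NavierStokesRegularity.Theorems.PoloidalWindowDoorLrcModEntireSonicSheetStrain
import Summits.NavierStokesRegularity.NavierStokesRegularity.Theorems.PoloidalWindowDoorLrcModEntireQ4SonicSpeedLawPackage
import Summits.NavierStokesRegularity.NavierStokesRegularity.Theorems.PoloidalWindowDoorLrcModEntireQ4SonicSheetDataPackage

/-!
# Route `PoloidalWindowDoor`, item `LrcModEntire` (stmt-NavierStokesRegularity-20428), cell (Q4-sonic, straight, μ < 0) `stub_Q4sonicLineNeg`, case I —
# S3 OF THE ASSEMBLY A-I IN PACKAGE CURRENCY: AT A SONIC TIME WITH PARALLEL WEBS THE STRAIN ROW ON THE SHEET IS `s`-FREE OR SINGLE-FREQUENCY PERIODIC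

Cell ns-regularity-ideate, stub-worker seat ns-poloidal-K2-p2 g17 under the LEAD of item 20428 (ns-poloidal-K2-p3 g17, PICK 2026-08-29T20:07:35Z «S3 WIRING =
the sheet-data dichotomy at class level»); `--supports stmt-NavierStokesRegularity-20428 --as helper`.  The class-level wrapper of the class-free core
`…SonicSheetStrain.sheet_trig_dichotomy`, with every input discharged by name from port-2 g8's `…Q4SonicSheetDataPackage.sonic_sheet_data_of_package` (S2:
characteristic relation, sheet gradient `σB·pr₂`, ridge value `σa = −κ`, `∂_zU_h = 0`), `…Q4SonicSpeedLawPackage.crossVelocity_of_package` (S3(b): `U·Je∘W = V +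
(1−μ)a₃/a + d′σR + 2μ_z d′/(1−μ)`) and `webSpeed_sfree_of_parallel` (the web speed `V` is `s`-free when the webs are parallel at all nearby times — K2-p2 g16's
B-T `…SonicWebsParallelWindow.sonic_webs_parallel_timeWeb_box`), the slice law (`plane_wave_identity`), poloidality (`curl·e₂ = 0` ⇒ symmetric horizontal block)
and incompressibility (`div_coord` ⇒ horizontal trace `−∂₂U₂ = −σB`).

* `nested3_eq` — `D(x ↦ D²θ(x)[a,b])(x)[v] = D³θ(x)[v,a,b]` (`θ ∈ C³`; the cubic-transport currency vs. the speed-law currency of `a₃`);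
* `inner_horizontal`, `frame_symm_trace` — inner products with `e`, `Je` in coordinates; symmetry and trace of the horizontal block of `DU` in the frame `(e, Je)`;
* ★★ `sheet_strain_dichotomy_of_package` — hypotheses: class `U`, `σ = ±1`, (TH) slab law with `C³` slope, horizontal unit `e`, the OUTPUT BLOCK `hpack` of
  `…Q4TimeWebPackage.time_web_package_line` on the window `δ′` (`δ′ ≤ ρ`, `δ′ < 1/2`), a SONIC time `|τ| < δ′` (`R(τ,·)` affine on `|z| < δ′`), PARALLEL WEBS on the
  box `|τ′|, |z| < δ′`, and `μ(−1+τ,·) < 0` on the window.  CONCLUSION (`t = −1+τ`, `W = frameCLM e (s, n₀(τ,s,z), z)`): EITHER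
  `⟪DU(t)(W)e, e⟫ = ⟪DU(t)(W)e, Je⟫ = 0` for all `s`, `|z| < δ′` — the web-frame strain row `(S_ee, S_eν)` vanishes on `Σ_τ`, i.e. the Cauchy data `P = Q = 0` of the
  mixed system (T2B-g17 §8(8a)) — OR there is ONE `ω > 0` with `U(t,W)·e`, `U(t,W)·Je` degree-one trigonometric polynomials in `ωs` with `z`-dependent
  coefficients, the second one non-trivial at every height (PERIODIC sheet data, period `2π/ω`, §8(8b)).

WHAT THIS IS NOT: not a claim about Navier–Stokes regularity and not a stub of the registry — the S3 step of the case-I chain of the research slot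
`stub_Q4sonicLineNeg` (registry twist_split v13); no stub is closed here; items 20428 / 19708 / 27893 OPEN (bears_on LADDER-NS N0).
-/

noncomputable section

set_option linter.dupNamespace false
set_option linter.style.longLine false

namespace Summit.NavierStokesRegularity.NavierStokesRegularity.Theorems.PoloidalWindowDoorLrcModEntireSonicSheetStrainPackage

open Set Function Filter Topology Metric
open scoped RealInnerProductSpace InnerProductSpace ContDiff
open Literature.Analysis Literature.Analysis.FluidPDE Literature.Analysis.UnboundedOperators
open Summit.NavierStokesRegularity.NavierStokesRegularity.Theorems
open Summit.NavierStokesRegularity.NavierStokesRegularity.Theorems.LocalSineTubeDoorProfileAlignedWindowRigidityAncient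
open Summit.NavierStokesRegularity.NavierStokesRegularity.Theorems.PoloidalWindowDoorPoloidalWindowRigidityWindow
open Summit.NavierStokesRegularity.NavierStokesRegularity.Theorems.PoloidalWindowDoorPoloidalWindowRigidityTimeHeightShearLinearSlice
open Summit.NavierStokesRegularity.NavierStokesRegularity.Theorems.PoloidalWindowDoorPoloidalWindowRigidityConstantShearSlice
open Summit.NavierStokesRegularity.NavierStokesRegularity.Theorems.PoloidalWindowDoorLrcModEntireSheetFlattenTools
open Summit.NavierStokesRegularity.NavierStokesRegularity.Theorems.PoloidalWindowDoorLrcModEntireParallelWebsIdentity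
open Summit.NavierStokesRegularity.NavierStokesRegularity.Theorems.PoloidalWindowDoorLrcModEntireRidgeGlobalBranchFrame
open Summit.NavierStokesRegularity.NavierStokesRegularity.Theorems.PoloidalWindowDoorLrcModEntireQ4SonicHotSheetTimeSplit
open Summit.NavierStokesRegularity.NavierStokesRegularity.Theorems.PoloidalWindowDoorLrcModEntireQ4SonicSheetDataPackage
open Summit.NavierStokesRegularity.NavierStokesRegularity.Theorems.PoloidalWindowDoorLrcModEntireQ4SonicSpeedLawPackage
open Summit.NavierStokesRegularity.NavierStokesRegularity.Theorems.PoloidalWindowDoorLrcModEntireSonicSheetStrain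

variable {C : ℝ} {U : ℝ → EuclideanSpace ℝ (Fin 3) → EuclideanSpace ℝ (Fin 3)} {R μ : ℝ → ℝ → ℝ} {σ r ρ δ' : ℝ} {e : EuclideanSpace ℝ (Fin 3)}
  {n₀ : ℝ × ℝ × ℝ → ℝ} {κt : ℝ → ℝ → ℝ}

/-- Third nested derivative vs. the third Fréchet derivative: `D(x ↦ D²θ(x)[a,b])(x)[v] = D³θ(x)[v,a,b]` for `θ ∈ C³`. -/
theorem nested3_eq {θ : EuclideanSpace ℝ (Fin 3) → ℝ} (hθ : ContDiff ℝ 3 θ) (x a b v : EuclideanSpace ℝ (Fin 3)) :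
    fderiv ℝ (fun y => fderiv ℝ (fderiv ℝ θ) y a b) x v = fderiv ℝ (fderiv ℝ (fderiv ℝ θ)) x v a b := by
  have hD2 : ContDiff ℝ 1 (fderiv ℝ (fderiv ℝ θ)) :=
    (hθ.fderiv_right (m := 2) (by norm_num)).fderiv_right (m := 1) (by norm_num)
  have hd : DifferentiableAt ℝ (fderiv ℝ (fderiv ℝ θ)) x := (hD2.differentiable (by simp)) x
  have h1 : DifferentiableAt ℝ (fun y => fderiv ℝ (fderiv ℝ θ) y a) x := hd.clm_apply (differentiableAt_const a)
  rw [fderiv_clm_apply h1 (differentiableAt_const b)]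
  rw [fderiv_clm_apply hd (differentiableAt_const a)]
  simp

/-- Inner products with a horizontal vector `e` and with `Je`, in coordinates. -/
theorem inner_horizontal {e : EuclideanSpace ℝ (Fin 3)} (he2 : e 2 = 0) (x : EuclideanSpace ℝ (Fin 3)) :
    ⟪x, e⟫ = x 0 * e 0 + x 1 * e 1 ∧ ⟪x, Jvec e⟫ = -(x 0 * e 1) + x 1 * e 0 := by
  have hJ : Jvec e 0 = -(e 1) ∧ Jvec e 1 = e 0 ∧ Jvec e 2 = 0 := by simp [Jvec]
  refine ⟨?_, ?_⟩
  · rw [inner_eq_sum3, he2]; ring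
  · rw [inner_eq_sum3, hJ.1, hJ.2.1, hJ.2.2]; ring

/-- The horizontal block of a linear map in the frame `(e, Je)`: symmetry from `L e₀·e₁ = L e₁·e₀`, and the trace. -/
theorem frame_symm_trace (L : EuclideanSpace ℝ (Fin 3) →L[ℝ] EuclideanSpace ℝ (Fin 3)) {e : EuclideanSpace ℝ (Fin 3)}
    (he2 : e 2 = 0) (hunit : e 0 ^ 2 + e 1 ^ 2 = 1) :
    (L (EuclideanSpace.single 0 (1 : ℝ)) 1 = L (EuclideanSpace.single 1 (1 : ℝ)) 0 → ⟪L e, Jvec e⟫ = ⟪L (Jvec e), e⟫) ∧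
    ⟪L e, e⟫ + ⟪L (Jvec e), Jvec e⟫ = L (EuclideanSpace.single 0 (1 : ℝ)) 0 + L (EuclideanSpace.single 1 (1 : ℝ)) 1 := by
  have hLe : L e = e 0 • L (EuclideanSpace.single 0 (1 : ℝ)) + e 1 • L (EuclideanSpace.single 1 (1 : ℝ)) := by
    conv_lhs => rw [horizontal_decomp he2]
    simp only [map_add, map_smul]
  have hLJ : L (Jvec e) = (-(e 1)) • L (EuclideanSpace.single 0 (1 : ℝ)) + e 0 • L (EuclideanSpace.single 1 (1 : ℝ)) := by
    rw [Jvec_decomp e]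
    simp only [map_add, map_smul]
  have h1 := (inner_horizontal he2 (L e)).2
  have h2 := (inner_horizontal he2 (L (Jvec e))).1
  have h3 := (inner_horizontal he2 (L e)).1
  have h4 := (inner_horizontal he2 (L (Jvec e))).2
  rw [h1, h2, h3, h4, hLe, hLJ]
  simp only [PiLp.add_apply, PiLp.smul_apply, smul_eq_mul]
  refine ⟨fun hcurl => ?_, ?_⟩
  · linear_combination (e 0 ^ 2 + e 1 ^ 2) * hcurl
  · linear_combination (L (EuclideanSpace.single 0 (1 : ℝ)) 0 + L (EuclideanSpace.single 1 (1 : ℝ)) 1) * hunit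

/-- ★★ **S3 AT ONE SONIC TIME (package currency): THE WEB-FRAME STRAIN ROW ON `Σ_τ` IS `s`-FREE OR SINGLE-FREQUENCY PERIODIC.**  Hypotheses: the class profile `U`,
`σ = ±1`, the (TH) slab law with `C³` slope, a horizontal unit `e`, THE OUTPUT BLOCK `hpack` of `…Q4TimeWebPackage.time_web_package_line` on the window `δ′`
(`δ′ ≤ ρ`, `δ′ < 1/2`), a time `|τ| < δ′` which is SONIC (`R(τ,·)` affine on `|z| < δ′`), PARALLEL WEBS on the whole box `|τ′|, |z| < δ′` (K2-p2's B-T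
`sonic_webs_parallel_timeWeb_box`) and a NEGATIVE slope `μ(−1+τ, z) < 0` on the window (so `d′ ≠ 0`).  Conclusion, with `t = −1+τ` and the web points
`W = frameCLM e (s, n₀(τ,s,z), z)`: EITHER `⟪DU(t)(W)e, e⟫ = ⟪DU(t)(W)e, Je⟫ = 0` for all `s` and `|z| < δ′` (s-FREE sheet data: the Cauchy data `P = Q = 0` of
T2B-g17 §8(8a)), OR there are `ω > 0` and coefficient functions with `U(t,W)·e = a₀(z) + a₁(z)cos(ωs) + b₁(z)sin(ωs)`, `U(t,W)·Je = a₀′(z) + a₁′(z)cos(ωs) +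
b₁′(z)sin(ωs)` for all `s`, `|z| < δ′`, and `(a₁′(z), b₁′(z)) ≠ (0,0)` (PERIODIC sheet data with the single period `2π/ω`, §8(8b)).  Proof = the class-free core
`…SonicSheetStrain.sheet_trig_dichotomy` with its inputs discharged by port-2's `sonic_sheet_data_of_package` (S2), `crossVelocity_of_package` (S3(b)) and
`webSpeed_sfree_of_parallel`. -/
theorem sheet_strain_dichotomy_of_package
    (hrate : HasTypeITimeDecay C U) (hcont : ContinuousOn (uncurry U) (Iio (0 : ℝ) ×ˢ univ))
    (hmild : ∀ s t : ℝ, s < t → t < 0 → ∀ x, U t x = heatExtension (U s) (t - s) x - oseenDuhamel 1 s U U t x)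
    (hdiv : ∀ t < 0, VectorCalculus.IsDivFree (U t))
    (hpol : ∀ s < 0, ∀ y, ⟪curl (U s) y, EuclideanSpace.single 2 1⟫_ℝ = 0)
    (hσ : σ = 1 ∨ σ = -1) (hμ3 : ContDiff ℝ 3 (uncurry μ))
    (hslabU : ∀ t : ℝ, |t + 1| < ρ → ∀ x : EuclideanSpace ℝ (Fin 3), |x 2| < ρ → ∀ b : Fin 3, b ≠ 2 →
      fderiv ℝ (U t) x (EuclideanSpace.single 2 1) b = μ t (x 2) * fderiv ℝ (U t) x (EuclideanSpace.single b 1) 2)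
    (hδ'ρ : δ' ≤ ρ) (hδ'h : δ' < 1 / 2) (he2 : e 2 = 0) (hunit : e 0 ^ 2 + e 1 ^ 2 = 1)
    (hpack : ∀ q : ℝ × ℝ × ℝ, |q.1| < δ' → |q.2.2| < δ' →
        n₀ q ∈ Ioo (-r) r ∧
        σ * U (-1 + q.1) (frameCLM e (q.2.1, n₀ q, q.2.2)) 2 = R q.1 q.2.2 ∧
        (∀ n ∈ Icc (-r) r, n ≠ n₀ q → σ * U (-1 + q.1) (frameCLM e (q.2.1, n, q.2.2)) 2 < R q.1 q.2.2) ∧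
        (∀ w : EuclideanSpace ℝ (Fin 3), w 2 = 0 → fderiv ℝ (fun y => U (-1 + q.1) y 2) (frameCLM e (q.2.1, n₀ q, q.2.2)) w = 0) ∧
        (∀ m : ℕ∞, ContDiffAt ℝ m n₀ q) ∧
        0 < κt q.1 q.2.2 ∧
        fderiv ℝ (fderiv ℝ (fun y => σ * U (-1 + q.1) y 2)) (frameCLM e (q.2.1, n₀ q, q.2.2)) e e +
            fderiv ℝ (fderiv ℝ (fun y => σ * U (-1 + q.1) y 2)) (frameCLM e (q.2.1, n₀ q, q.2.2)) (Jvec e) (Jvec e) =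
          -κt q.1 q.2.2 ∧
        κt q.1 q.2.2 * (fderiv ℝ n₀ q ((0 : ℝ), (0 : ℝ), (1 : ℝ))) ^ 2 =
          (deriv (deriv (R q.1)) q.2.2 - μ (-1 + q.1) q.2.2 * κt q.1 q.2.2) * (1 + (fderiv ℝ n₀ q ((0 : ℝ), (1 : ℝ), (0 : ℝ))) ^ 2))
    {τ : ℝ} (hτ : |τ| < δ') (hson : ∃ A B : ℝ, ∀ z : ℝ, |z| < δ' → R τ z = A + B * z)
    (hparN : ∀ τ' s z : ℝ, |τ'| < δ' → |z| < δ' → n₀ (τ', s, z) = n₀ (τ', (0 : ℝ), z))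
    (hμneg : ∀ z : ℝ, |z| < δ' → μ (-1 + τ) z < 0) :
    (∀ s z : ℝ, |z| < δ' →
        ⟪fderiv ℝ (U (-1 + τ)) (frameCLM e (s, n₀ (τ, s, z), z)) e, e⟫ = 0 ∧
        ⟪fderiv ℝ (U (-1 + τ)) (frameCLM e (s, n₀ (τ, s, z), z)) e, Jvec e⟫ = 0) ∨
    (∃ w : ℝ, 0 < w ∧ ∃ a₀ a₁ b₁ a₀' a₁' b₁' : ℝ → ℝ, (∀ z : ℝ, |z| < δ' → a₁' z ≠ 0 ∨ b₁' z ≠ 0) ∧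
      ∀ s z : ℝ, |z| < δ' →
        ⟪U (-1 + τ) (frameCLM e (s, n₀ (τ, s, z), z)), e⟫ = a₀ z + a₁ z * Real.cos (w * s) + b₁ z * Real.sin (w * s) ∧
        ⟪U (-1 + τ) (frameCLM e (s, n₀ (τ, s, z), z)), Jvec e⟫ = a₀' z + a₁' z * Real.cos (w * s) + b₁' z * Real.sin (w * s)) := by
  have hpar : ∀ s z : ℝ, |z| < δ' → n₀ (τ, s, z) = n₀ (τ, (0 : ℝ), z) := fun s z hz => hparN τ s z hτ hz
  set t : ℝ := -1 + τ with ht_def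
  have hτh : |τ| < 1 / 2 := lt_of_lt_of_le hτ hδ'h.le
  have hτρ : |τ| < ρ := lt_of_lt_of_le hτ hδ'ρ
  have ht : t < 0 := by rw [ht_def]; linarith [(abs_lt.1 hτh).2]
  have hth : t < -(1 / 2 : ℝ) := by rw [ht_def]; linarith [(abs_lt.1 hτh).2]
  have hδ' : 0 < δ' := lt_of_le_of_lt (abs_nonneg _) hτ
  set θ : EuclideanSpace ℝ (Fin 3) → ℝ := fun y => U t y 2 with hθ_def
  set d : ℝ → ℝ := fun z' => n₀ (τ, (0 : ℝ), z') with hd_def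
  set I : Set ℝ := Ioo (-δ') δ' with hI_def
  have hI : IsOpen I := isOpen_Ioo
  have hIc : IsPreconnected I := isPreconnected_Ioo
  have hImem : ∀ {z' : ℝ}, |z'| < δ' → z' ∈ I := fun hz' => by rw [hI_def, mem_Ioo]; exact ⟨by linarith [(abs_lt.1 hz').1], (abs_lt.1 hz').2⟩
  have hIabs : ∀ {z' : ℝ}, z' ∈ I → |z'| < δ' := fun hz' => by rw [hI_def, mem_Ioo] at hz'; exact abs_lt.2 ⟨by linarith [hz'.1], hz'.2⟩
  have hIρ : ∀ z' ∈ I, |z'| < ρ := fun z' hz' => lt_of_lt_of_le (hIabs hz') hδ'ρ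
  have hz₀ : (0 : ℝ) ∈ I := hImem (by simpa using hδ')
  /- regularity of the slice -/
  have hUan : AnalyticOnNhd ℝ (U t) univ := analyticOnNhd_slice hcont (bdd_of_hasTypeITimeDecay hrate) hmild ht
  have hu : ContDiff ℝ ∞ (U t) := hUan.contDiff
  have hθ : ContDiff ℝ ∞ θ := by
    have : θ = (fun v : EuclideanSpace ℝ (Fin 3) => v 2) ∘ U t := rfl
    rw [this]; exact ((EuclideanSpace.proj (𝕜 := ℝ) (2 : Fin 3)).contDiff).comp hu
  have hθ2 : ContDiff ℝ 2 θ := hθ.of_le (by norm_cast)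
  have hθ3 : ContDiff ℝ 3 θ := hθ.of_le (by norm_cast)
  have hθd : Differentiable ℝ θ := hθ.differentiable (by simp)
  have hUd : Differentiable ℝ (U t) := hu.differentiable (by simp)
  obtain ⟨Bu, hBu⟩ := bdd_of_hasTypeITimeDecay hrate (1 / 2) (by norm_num)
  have hubdd : ∀ y, ‖U t y‖ ≤ Bu := fun y => hBu t hth y
  have hn₀d : ∀ s' z' : ℝ, |z'| < δ' → DifferentiableAt ℝ n₀ (τ, s', z') := fun s' z' hz' =>
    ((hpack (τ, s', z') hτ hz').2.2.2.2.1 1).differentiableAt (by simp)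
  -- the web points at time `τ` lie on the straight sheet of `d`
  have hWeq : ∀ s' z' : ℝ, |z'| < δ' → frameCLM e (s', n₀ (τ, s', z'), z') = s' • e + d z' • Jvec e + z' • e2 := by
    intro s' z' hz'
    rw [frameCLM_apply, hpar s' z' hz']
  have hdz : ∀ s' z' : ℝ, |z'| < δ' → HasDerivAt (fun a : ℝ => n₀ (τ, s', a)) (fderiv ℝ n₀ (τ, s', z') ((0 : ℝ), (0 : ℝ), (1 : ℝ))) z' :=
    fun s' z' hz' => (hn₀d s' z' hz').hasFDerivAt.comp_hasDerivAt z' (hasDerivAt_zLine τ s' z')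
  have hdd : ∀ z' : ℝ, |z'| < δ' → HasDerivAt d (fderiv ℝ n₀ (τ, (0 : ℝ), z') ((0 : ℝ), (0 : ℝ), (1 : ℝ))) z' := fun z' hz' => hdz 0 z' hz'
  have hd : ContDiffOn ℝ ∞ d I := by
    intro z' hz'
    have h := (hpack (τ, (0 : ℝ), z') hτ (hIabs hz')).2.2.2.2.1 ⊤
    have hline : ContDiff ℝ ∞ (fun a : ℝ => ((τ, (0 : ℝ), a) : ℝ × ℝ × ℝ)) :=
      contDiff_const.prodMk (contDiff_const.prodMk contDiff_id)
    exact (h.comp z' hline.contDiffAt).contDiffWithinAt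
  /- the sonic literal -/
  obtain ⟨A, B, hAB⟩ := hson
  /- S2 at every point of the sheet -/
  have hS2 := fun (s' : ℝ) {z' : ℝ} (hz' : |z'| < δ') =>
    sonic_sheet_data_of_package (κt := κt) hrate hcont hmild hdiv hσ hμ3 hslabU hδ'ρ hδ'h he2 hunit hpack hτ ⟨A, B, hAB⟩ hpar s' hz'
  /- (1) slope: differentiable, negative ⇒ `d′ ≠ 0`; the characteristic relation -/
  have hμfun : μ t = uncurry μ ∘ fun z : ℝ => (t, z) := by funext z; rfl
  have hμt3 : ContDiff ℝ 3 (μ t) := by rw [hμfun]; exact hμ3.comp (contDiff_const.prodMk contDiff_id)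
  have hμ₁ : ∀ z ∈ I, DifferentiableAt ℝ (μ t) z := fun z _ => (hμt3.differentiable (by norm_num)) z
  have hQ0 : ∀ z ∈ I, deriv d z ^ 2 + μ t z = 0 := fun z hz => (hS2 0 (hIabs hz)).2.1
  have hd0 : ∀ z ∈ I, deriv d z ≠ 0 := by
    intro z hz h0
    have h := hQ0 z hz
    rw [h0] at h
    have := hμneg z (hIabs hz)
    rw [ht_def] at h
    linarith
  /- (2) the slice law on the slab -/
  have hplane : ∀ z : ℝ, |z| < ρ → ∀ y : EuclideanSpace ℝ (Fin 3), y 2 = z → ∀ b : Fin 3, b ≠ 2 →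
      fderiv ℝ (U t) y (EuclideanSpace.single 2 (1 : ℝ)) b = μ t z * fderiv ℝ (U t) y (EuclideanSpace.single b (1 : ℝ)) 2 := by
    intro z hz y hy b hb
    have htρ : |t + 1| < ρ := by rw [ht_def]; simpa using hτρ
    have h := hslabU t htρ y (by rw [hy]; exact hz) b hb
    rw [hy] at h; exact h
  have hlaw : ∀ x : EuclideanSpace ℝ (Fin 3), x 2 ∈ I →
      fderiv ℝ (fun y => fderiv ℝ θ y (EuclideanSpace.single 2 (1 : ℝ))) x (EuclideanSpace.single 2 (1 : ℝ)) =
        -μ t (x 2) * (fderiv ℝ (fun y => fderiv ℝ θ y (EuclideanSpace.single 0 (1 : ℝ))) x (EuclideanSpace.single 0 (1 : ℝ)) +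
          fderiv ℝ (fun y => fderiv ℝ θ y (EuclideanSpace.single 1 (1 : ℝ))) x (EuclideanSpace.single 1 (1 : ℝ))) := fun x hx =>
    plane_wave_identity (hu.of_le (by norm_cast)) (fun y => div_coord (hdiv t ht) y) (hplane (x 2) (hIρ _ hx)) rfl
  /- (3) web criticality, s-homogeneous transversal Hessian, vanishing vertical derivative, symmetry, trace -/
  have hweb : ∀ s : ℝ, ∀ z ∈ I, fderiv ℝ θ (s • e + d z • Jvec e + z • e2) (Jvec e) = 0 := by
    intro s z hz
    obtain ⟨-, -, -, hhor, -, -, -, -⟩ := hpack (τ, s, z) hτ (hIabs hz)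
    simp only at hhor
    rw [hWeq s z (hIabs hz)] at hhor
    exact hhor (Jvec e) (by simp [Jvec])
  have hσσ : σ * σ = 1 := by rcases hσ with h | h <;> simp [h]
  have hσ0 : σ ≠ 0 := by rcases hσ with h | h <;> simp [h]
  have haJ : ∀ s : ℝ, ∀ z ∈ I, fderiv ℝ (fderiv ℝ θ) (s • e + d z • Jvec e + z • e2) (Jvec e) (Jvec e) = -σ * κt τ z := by
    intro s z hz
    have h := (hS2 s (hIabs hz)).2.2.2.2.2.1
    rw [hWeq s z (hIabs hz)] at h
    have h2 : σ * (σ * fderiv ℝ (fderiv ℝ θ) (s • e + d z • Jvec e + z • e2) (Jvec e) (Jvec e)) = σ * (-κt τ z) := by rw [h]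
    rw [← mul_assoc, hσσ, one_mul] at h2
    rw [h2]; ring
  have hhom : ∀ s s' : ℝ, ∀ z ∈ I,
      fderiv ℝ (fderiv ℝ θ) (s • e + d z • Jvec e + z • e2) (Jvec e) (Jvec e) =
        fderiv ℝ (fderiv ℝ θ) (s' • e + d z • Jvec e + z • e2) (Jvec e) (Jvec e) := by
    intro s s' z hz
    rw [haJ s z hz, haJ s' z hz]
  have hvz : ∀ s : ℝ, ∀ z ∈ I, ⟪fderiv ℝ (U t) (s • e + d z • Jvec e + z • e2) e2, e⟫ = 0 ∧
      ⟪fderiv ℝ (U t) (s • e + d z • Jvec e + z • e2) e2, Jvec e⟫ = 0 := by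
    intro s z hz
    have h9 := (hS2 s (hIabs hz)).2.2.2.2.2.2.2.2
    rw [hWeq s z (hIabs hz)] at h9
    have h0 : fderiv ℝ (U t) (s • e + d z • Jvec e + z • e2) e2 0 = 0 := h9 0 (by decide)
    have h1 : fderiv ℝ (U t) (s • e + d z • Jvec e + z • e2) e2 1 = 0 := h9 1 (by decide)
    refine ⟨?_, ?_⟩
    · rw [(inner_horizontal he2 _).1, h0, h1]; ring
    · rw [(inner_horizontal he2 _).2, h0, h1]; ring
  have hcurl : ∀ y, fderiv ℝ (U t) y (EuclideanSpace.single 0 (1 : ℝ)) 1 = fderiv ℝ (U t) y (EuclideanSpace.single 1 (1 : ℝ)) 0 := by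
    intro y
    have h := hpol t ht y
    rw [EuclideanSpace.inner_single_right] at h
    have h2 : curl (U t) y 2 = 0 := by simpa using h
    simp only [curl] at h2
    have h3 : fderiv ℝ (U t) y (EuclideanSpace.single 0 1) 1 - fderiv ℝ (U t) y (EuclideanSpace.single 1 1) 0 = 0 := by
      simpa using h2
    linarith
  have hpolW : ∀ s : ℝ, ∀ z ∈ I, ⟪fderiv ℝ (U t) (s • e + d z • Jvec e + z • e2) e, Jvec e⟫ =
      ⟪fderiv ℝ (U t) (s • e + d z • Jvec e + z • e2) (Jvec e), e⟫ := fun s z _ =>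
    (frame_symm_trace (fderiv ℝ (U t) (s • e + d z • Jvec e + z • e2)) he2 hunit).1 (hcurl _)
  -- the trace: `⟪DU e,e⟫ + ⟪DU Je,Je⟫ = −∂₂U₂ = −σB`
  have hgrad3 : ∀ s : ℝ, ∀ z ∈ I, fderiv ℝ (U t) (s • e + d z • Jvec e + z • e2) (EuclideanSpace.single 2 (1 : ℝ)) 2 = σ * B := by
    intro s z hz
    have h3 := (hS2 s (hIabs hz)).2.2.1 e2
    rw [hWeq s z (hIabs hz)] at h3
    -- `deriv (R τ) z = B`
    have hRev : (R τ) =ᶠ[𝓝 z] fun z'' => A + B * z'' := by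
      filter_upwards [hI.mem_nhds hz] with z'' hz'' using hAB z'' (hIabs hz'')
    have hlinB : HasDerivAt (fun z'' : ℝ => A + B * z'') B z := by simpa using ((hasDerivAt_id z).const_mul B).const_add A
    have hR' : deriv (R τ) z = B := by rw [hRev.deriv_eq, hlinB.deriv]
    have hcoord : fderiv ℝ (U t) (s • e + d z • Jvec e + z • e2) e2 2 = fderiv ℝ θ (s • e + d z • Jvec e + z • e2) e2 := by
      have h := ((EuclideanSpace.proj (𝕜 := ℝ) (2 : Fin 3)).hasFDerivAt.comp _ (hUd (s • e + d z • Jvec e + z • e2)).hasFDerivAt).fderiv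
      have e3 : (⇑(EuclideanSpace.proj (𝕜 := ℝ) (2 : Fin 3)) ∘ U t) = θ := by funext y; simp [hθ_def]
      rw [e3] at h
      rw [h]; rfl
    rw [show (EuclideanSpace.single 2 (1 : ℝ) : EuclideanSpace ℝ (Fin 3)) = e2 from rfl, hcoord, h3, hR']
    simp [e2]
  have htr : ∀ s : ℝ, ∀ z ∈ I, ⟪fderiv ℝ (U t) (s • e + d z • Jvec e + z • e2) e, e⟫ +
      ⟪fderiv ℝ (U t) (s • e + d z • Jvec e + z • e2) (Jvec e), Jvec e⟫ = -(σ * B) := by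
    intro s z hz
    rw [(frame_symm_trace (fderiv ℝ (U t) (s • e + d z • Jvec e + z • e2)) he2 hunit).2]
    have hdv := div_coord (hdiv t ht) (s • e + d z • Jvec e + z • e2)
    rw [hgrad3 s z hz] at hdv
    linarith
  /- (4) the cross-web velocity structure -/
  set aJ : ℝ → ℝ := fun z => fderiv ℝ (fderiv ℝ θ) ((0 : ℝ) • e + d z • Jvec e + z • e2) (Jvec e) (Jvec e) with haJ_def
  have haJI : ∀ z ∈ I, aJ z = -σ * κt τ z := fun z hz => haJ 0 z hz
  have haJ0 : ∀ z ∈ I, aJ z ≠ 0 := by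
    intro z hz
    rw [haJI z hz]
    have hκ := (hpack (τ, (0 : ℝ), z) hτ (hIabs hz)).2.2.2.2.2.1
    simp only at hκ
    exact mul_ne_zero (neg_ne_zero.2 hσ0) hκ.ne'
  have haJs : ContDiffOn ℝ ∞ aJ I := by
    have hK2 : ContDiff ℝ ∞ (fun x => fderiv ℝ (fderiv ℝ θ) x (Jvec e) (Jvec e)) :=
      (((hθ.fderiv_right (m := ∞) (by norm_cast)).fderiv_right (m := ∞) (by norm_cast)).clm_apply contDiff_const).clm_apply contDiff_const
    have hline : ContDiffOn ℝ ∞ (fun z : ℝ => (0 : ℝ) • e + d z • Jvec e + z • e2) I :=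
      ((contDiffOn_const).add (hd.smul contDiffOn_const)).add (contDiff_id.smul contDiff_const).contDiffOn
    exact hK2.comp_contDiffOn hline
  set E : ℝ → ℝ := fun z => (1 - μ t z) / aJ z with hE_def
  have hE : ContDiffOn ℝ 2 E I := by
    have h1 : ContDiffOn ℝ 2 (fun z => 1 - μ t z) I := (contDiff_const.sub (hμt3.of_le (by norm_cast))).contDiffOn
    exact h1.div (haJs.of_le (by norm_cast)) haJ0
  have hμle : ∀ z ∈ I, μ t z ≤ 0 := fun z hz => by have := hμneg z (hIabs hz); rw [ht_def]; exact this.le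
  have hE0 : ∀ z ∈ I, E z ≠ 0 := by
    intro z hz
    have h1 : 1 - μ t z ≠ 0 := by have := hμle z hz; intro h; linarith
    exact div_ne_zero h1 (haJ0 z hz)
  set g : ℝ → ℝ := fun z => fderiv ℝ n₀ (τ, (0 : ℝ), z) ((1 : ℝ), (0 : ℝ), (0 : ℝ)) + deriv d z * (σ * R τ z) +
    2 * deriv (μ t) z * deriv d z / (1 - μ t z) with hg_def
  have hcross : ∀ s : ℝ, ∀ z ∈ I, ⟪U t (s • e + d z • Jvec e + z • e2), Jvec e⟫ =
      g z + E z * fderiv ℝ (fun x => fderiv ℝ (fderiv ℝ θ) x (Jvec e) (Jvec e)) (s • e + d z • Jvec e + z • e2) (Jvec e) := by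
    intro s z hz
    have hza := hIabs hz
    have ha : fderiv ℝ (fderiv ℝ (fun y => U (-1 + τ) y 2)) (frameCLM e (s, n₀ (τ, s, z), z)) (Jvec e) (Jvec e) ≠ 0 := by
      rw [hWeq s z hza]
      show fderiv ℝ (fderiv ℝ θ) (s • e + d z • Jvec e + z • e2) (Jvec e) (Jvec e) ≠ 0
      rw [hhom s 0 z hz]; exact haJ0 z hz
    have hcv := crossVelocity_of_package (κt := κt) hrate hcont hmild hdiv hpol hσ hμ3 hslabU hδ'ρ hδ'h he2 hunit hpack hτ ⟨A, B, hAB⟩ hpar s hza ha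
    rw [hWeq s z hza] at hcv
    -- the web speed is `s`-free
    have hparev : ∀ᶠ a in 𝓝 τ, n₀ (a, s, z) = n₀ (a, (0 : ℝ), z) := by
      have hmem : {a : ℝ | |a| < δ'} ∈ 𝓝 τ := (isOpen_lt continuous_abs continuous_const).mem_nhds hτ
      filter_upwards [hmem] with a ha using hparN a s z ha hza
    have hV := webSpeed_sfree_of_parallel (n₀ := n₀) hparev (hn₀d s z hza) (hn₀d 0 z hza)
    rw [hV] at hcv
    rw [(inner_horizontal he2 _).2]
    have hlhs : -(U t (s • e + d z • Jvec e + z • e2) 0 * e 1) + U t (s • e + d z • Jvec e + z • e2) 1 * e 0 =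
        U (-1 + τ) (s • e + d z • Jvec e + z • e2) 1 * e 0 - U (-1 + τ) (s • e + d z • Jvec e + z • e2) 0 * e 1 := by
      rw [ht_def]; ring
    rw [hlhs, hcv, nested3_eq hθ3]
    change fderiv ℝ n₀ (τ, 0, z) (1, 0, 0) +
        (1 - μ (-1 + τ) z) * fderiv ℝ (fderiv ℝ (fderiv ℝ θ)) (s • e + d z • Jvec e + z • e2) (Jvec e) (Jvec e) (Jvec e) /
          fderiv ℝ (fderiv ℝ θ) (s • e + d z • Jvec e + z • e2) (Jvec e) (Jvec e) +
        deriv (fun z' => n₀ (τ, 0, z')) z * (σ * R τ z) +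
        2 * deriv (μ (-1 + τ)) z * deriv (fun z' => n₀ (τ, 0, z')) z / (1 - μ (-1 + τ) z) =
      g z + E z * fderiv ℝ (fderiv ℝ (fderiv ℝ θ)) (s • e + d z • Jvec e + z • e2) (Jvec e) (Jvec e) (Jvec e)
    rw [hhom s 0 z hz]
    simp only [hg_def, hE_def, haJ_def, hd_def, ht_def]
    ring
  /- (5) the core -/
  have hmain := sheet_trig_dichotomy (u := U t) (e := e) (d := d) (μ₁ := μ t) (E := E) (g := g) (I := I) (c := -(σ * B)) (Bu := Bu) (z₀ := 0)
    hu hubdd hI hIc hz₀ hd hd0 hμ₁ he2 hunit hlaw hQ0 hweb hhom hvz hpolW htr hE hE0 hcross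
  rcases hmain with hfree | ⟨w, hw, a₀, a₁, b₁, a₀', a₁', b₁', hnt, hform⟩
  · left
    intro s z hz
    rw [hWeq s z hz]
    exact hfree s z (hImem hz)
  · right
    refine ⟨w, hw, a₀, a₁, b₁, a₀', a₁', b₁', fun z hz => hnt z (hImem hz), fun s z hz => ?_⟩
    rw [hWeq s z hz]
    exact hform s z (hImem hz)

end Summit.NavierStokesRegularity.NavierStokesRegularity.Theorems.PoloidalWindowDoorLrcModEntireSonicSheetStrainPackage

end
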